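import Summits.CriticalPhenomena.PercolationContinuityZ3.Theorems.PercNearOneGluingNoHeavyLowerTailSahiCombMasterFamily

/-!
# The comb (tensor-Bernstein) hierarchy for Sahi's `E_k`, IV: the `k`-copy kernel and the EXPLICIT comb coefficients,
# uniform in `k` — replica lemma, Bernstein expansion with explicit coefficients, and the face lemmas

Support file of the one-cut programme (crux `NoHeavyLowerTail`, stmt-CriticalPhenomena-4575; cell `prim-masterthm`, seat P5,
`run/shared/lean/prim/prim-masterthm/prim-masterthm-p5/P5-LORENTZIAN-TEST.md` §7.3; companion of P3's `…SahiCombPositivity` /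
`…SahiCombMasterFamily`, whose certificate class `CombPos` is EXISTENTIAL — "some nonnegative tensor-Bernstein representation").
Honest label: Sahi's `C_k` (`k ≥ 3`) and the coefficientwise master statement (M⁺-k) are OPEN; this file proves identities only.

To STATE shape laws of the comb array (unimodality, end-minimum, end-order — file `…SahiCombShape`) one needs THE coefficients,
not a representation.  This file constructs them for every `k` at once, with no counting and no closed form of `E_k`:

* `SahiComb.copyKernel n f ω` — the **`n`-copy kernel**: the Lieb–Sahi recursion defining `sahiE` (tree
  `Literature.Combinatorics.Sahi2008.sahiE`) run on `n` independent copies `ω : Fin n → α`, the head function living on its own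
  copy; `copyKernel_congr` (locality: the kernel reads only the values `f_i(ω_c)`), `copyKernel_add_two_eq_zero_of_const`
  (constant families are killed from order `2` on — the kernel form of `E_n(1,…,1) = 0`);
* **`SahiComb.sahiE_eq_sum_copyKernel`** — the REPLICA LEMMA: for a probability weight `μ`,
  `E_n(μ; f) = Σ_{ω ∈ α^n} (∏_c μ(ω_c)) · K_n(f)(ω)`;
* `SahiComb.profile ω` (`j_e = #{c | e ∈ ω_c}`) and **`SahiComb.combCoeff n f j`** — the fibre sum of the kernel over the copies
  with profile `j` (for indicator families: the integer `n`-copy fibre counts of MASTER-FAMILY.md §MASTER / P3's HIERARCHY §1);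
* `SahiComb.prod_bernoulliWeight_eq_bern` — `∏_c μ_p(ω_c) = ∏_e p_e^{j_e}(1−p_e)^{n−j_e}` (P3's basis function `bern`), hence
  **`SahiComb.sahiE_bernoulliWeight_eq_sum_combCoeff`**: `E_n(μ_p; f) = Σ_{j ≤ n} combCoeff(f; j)·∏_e p_e^{j_e}(1−p_e)^{n−j_e}` —
  the degree-`n` tensor-Bernstein expansion of `p ↦ E_n(μ_p; f)` with EXPLICIT coefficients, uniform in `n` (the tree had it for
  `n = 4` only, `SahiC4Cube.sahiE4_bernstein_expansion`, via bitmask tables); `SahiComb.combPos_of_combCoeff_nonneg`: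
  coefficientwise nonnegativity is a `CombPos` certificate;
* FACE LEMMAS `SahiComb.combCoeff_ind_eq_secAt_false` / `…_true`: on the face `j_e = 0` (resp. `j_e = n`) the comb array of
  `(1_{U_i})` IS the comb array of the sections `(1_{U_i^{e←0}})` (resp. `e←1`; tree `secAt`) — the two ends of every
  coefficient line are coefficients of tuples living on one coordinate fewer; `SahiComb.combCoeff_ind_nonneg_of_trivial` (base
  of the coordinate induction).
Everything here is proved; axioms standard. [this work]
-/

noncomputable section

open scoped Classical

namespace Summit.CriticalPhenomena.PercolationContinuityZ3.Theorems

open Finset Function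
open Literature.Combinatorics.Sahi2008
open Literature.Probability.Percolation (DeterminedBy determinedBy_iff)
open Literature.Probability.Percolation.DecisionTree (ind ind_of_mem ind_of_not_mem ind_nonneg)
open SahiComb

namespace SahiComb

/-! ### The `k`-copy kernel -/

section Kernel

variable {α : Type*}

/-- **The `k`-copy kernel** `K_n(f)(ω_0,…,ω_{n−1})` of Sahi's functional: the Lieb–Sahi recursion
`E_{n+2}(f_0, g) = Σ_i E_{n+1}(g with g_i ↦ g_i·f_0) − E_{n+1}(g)·E(f_0)` run on `n` INDEPENDENT copies, the head function
`f_0` being evaluated on its own copy `ω_0` in the product term (`K_1(f)(ω) = f_0(ω_0)`, junk `K_0 = 0`).  Integrating the copies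
out under a probability weight returns `E_n` (`sahiE_eq_sum_copyKernel`). [this work] -/
def copyKernel : (n : ℕ) → (Fin n → α → ℝ) → (Fin n → α) → ℝ
  | 0, _, _ => 0
  | 1, f, ω => f 0 (ω 0)
  | n + 2, f, ω =>
      (∑ i : Fin (n + 1), copyKernel (n + 1) (update (Fin.tail f) i (Fin.tail f i * f 0)) (Fin.tail ω)) -
        copyKernel (n + 1) (Fin.tail f) (Fin.tail ω) * f 0 (ω 0)

/-- `K_0 = 0`. [this work] -/
theorem copyKernel_zero (f : Fin 0 → α → ℝ) (ω : Fin 0 → α) : copyKernel 0 f ω = 0 := rfl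

/-- `K_1(f)(ω) = f_0(ω_0)`. [this work] -/
theorem copyKernel_one (f : Fin 1 → α → ℝ) (ω : Fin 1 → α) : copyKernel 1 f ω = f 0 (ω 0) := rfl

/-- The recursion step of the kernel. [this work] -/
theorem copyKernel_succ_succ (n : ℕ) (f : Fin (n + 2) → α → ℝ) (ω : Fin (n + 2) → α) :
    copyKernel (n + 2) f ω =
      (∑ i : Fin (n + 1), copyKernel (n + 1) (update (Fin.tail f) i (Fin.tail f i * f 0)) (Fin.tail ω)) -
        copyKernel (n + 1) (Fin.tail f) (Fin.tail ω) * f 0 (ω 0) := rfl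

/-- **Locality**: the kernel only reads the values `f_i(ω_c)`. [this work] -/
theorem copyKernel_congr : ∀ (n : ℕ) {f g : Fin n → α → ℝ} {ω : Fin n → α},
    (∀ i c, f i (ω c) = g i (ω c)) → copyKernel n f ω = copyKernel n g ω
  | 0, _, _, _, _ => rfl
  | 1, _, _, _, h => h 0 0
  | n + 2, f, g, ω, h => by
    rw [copyKernel_succ_succ, copyKernel_succ_succ]
    have ht : ∀ i c, Fin.tail f i (Fin.tail ω c) = Fin.tail g i (Fin.tail ω c) := fun i c => h i.succ c.succ
    rw [copyKernel_congr (n + 1) ht, h 0 0]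
    congr 1
    refine sum_congr rfl fun i _ => copyKernel_congr (n + 1) fun i' c => ?_
    by_cases hi : i' = i
    · subst hi
      simp only [update_self, Pi.mul_apply]
      rw [ht, show f 0 (Fin.tail ω c) = g 0 (Fin.tail ω c) from h 0 c.succ]
    · simp only [update_of_ne hi]
      exact ht i' c

/-- **Constants are killed from order `2` on**: if every `f_i` is a constant function then `K_{n+2}(f) ≡ 0`
(the kernel analogue of `E_n(1,…,1) = 0`, Sahi's Theorem 6). [this work] -/
theorem copyKernel_add_two_eq_zero_of_const : ∀ (n : ℕ) {f : Fin (n + 2) → α → ℝ} (ω : Fin (n + 2) → α),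
    (∀ i x y, f i x = f i y) → copyKernel (n + 2) f ω = 0
  | 0, f, ω, h => by
    show (∑ i : Fin 1, copyKernel 1 (update (Fin.tail f) i (Fin.tail f i * f 0)) (Fin.tail ω)) -
        copyKernel 1 (Fin.tail f) (Fin.tail ω) * f 0 (ω 0) = 0
    rw [Fin.sum_univ_one, copyKernel_one, copyKernel_one, update_self, Pi.mul_apply,
      h 0 (Fin.tail ω 0) (ω 0)]
    ring
  | n + 1, f, ω, h => by
    have h1 : copyKernel (n + 1 + 1) (Fin.tail f) (Fin.tail ω) = 0 :=
      copyKernel_add_two_eq_zero_of_const n (Fin.tail ω) fun i x y => h i.succ x y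
    rw [copyKernel_succ_succ, h1, zero_mul, sub_zero]
    refine sum_eq_zero fun i _ => ?_
    refine (copyKernel_add_two_eq_zero_of_const n (Fin.tail ω) fun i' x y => ?_ :
      copyKernel (n + 2) (update (Fin.tail f) i (Fin.tail f i * f 0)) (Fin.tail ω) = 0)
    by_cases hi : i' = i
    · subst hi
      simp only [update_self, Pi.mul_apply]
      rw [show Fin.tail f i' x = Fin.tail f i' y from h _ x y, h 0 x y]
    · simp only [update_of_ne hi]
      exact h _ x y

variable [Fintype α]

/-- Splitting a sum over `α^{n+1}` into the head coordinate and the tail (Fubini for `Fin.cons`). [folklore] -/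
theorem sum_pi_fin_succ {M : Type*} [AddCommMonoid M] (n : ℕ) (G : (Fin (n + 1) → α) → M) :
    ∑ ω, G ω = ∑ x : α, ∑ ω' : Fin n → α, G (Fin.cons x ω') := by
  rw [← Fintype.sum_prod_type']
  refine Fintype.sum_equiv (Fin.consEquiv fun _ : Fin (n + 1) => α).symm _ (fun q => G (Fin.cons q.1 q.2))
    fun ω => ?_
  simp only [Fin.consEquiv_symm_apply, Fin.cons_self_tail]

/-- **Replica lemma**: under a probability weight, `E_n(f) = Σ_{ω ∈ α^n} (∏_c μ(ω_c)) · K_n(f)(ω)` — Sahi's functional is the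
expectation of the `n`-copy kernel under `n` independent copies. [this work] -/
theorem sahiE_eq_sum_copyKernel {μ : α → ℝ} (hμ : ∑ x, μ x = 1) :
    ∀ (n : ℕ) (f : Fin n → α → ℝ), sahiE μ n f = ∑ ω : Fin n → α, (∏ c, μ (ω c)) * copyKernel n f ω
  | 0, f => by simp [sahiE_zero, copyKernel_zero]
  | 1, f => by
    rw [sahiE_one_apply, ex_def, ← (Equiv.funUnique (Fin 1) α).symm.sum_comp]
    refine sum_congr rfl fun x _ => ?_
    simp [copyKernel_one, Equiv.funUnique]
  | n + 2, f => by
    rw [sahiE_succ_succ]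
    simp_rw [sahiE_eq_sum_copyKernel hμ (n + 1), copyKernel_succ_succ]
    rw [sum_pi_fin_succ (n + 1)]
    simp only [Fin.prod_univ_succ (n := n + 1), Fin.cons_zero, Fin.cons_succ, Fin.tail_cons]
    have key : ∀ (x : α) (ω : Fin (n + 1) → α),
        (μ x * ∏ c, μ (ω c)) *
            ((∑ i, copyKernel (n + 1) (update (Fin.tail f) i (Fin.tail f i * f 0)) ω) -
              copyKernel (n + 1) (Fin.tail f) ω * f 0 x) =
          μ x * ((∏ c, μ (ω c)) * ∑ i, copyKernel (n + 1) (update (Fin.tail f) i (Fin.tail f i * f 0)) ω) -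
            μ x * f 0 x * ((∏ c, μ (ω c)) * copyKernel (n + 1) (Fin.tail f) ω) := fun x ω => by ring
    rw [ex_def]
    simp only [key, sum_sub_distrib, ← mul_sum, ← sum_mul, hμ, one_mul]
    congr 1
    · simp only [mul_sum]
      exact sum_comm
    · ring

end Kernel

/-! ### Copy profiles and the explicit comb coefficients -/

section Comb

variable {ι : Type*} [Fintype ι]

/-- The **profile** of an `n`-tuple of configurations: `j_e = #{c | e ∈ ω_c}`, the number of copies open at `e`. [this work] -/
def profile {n : ℕ} (ω : Fin n → Set ι) : ι → ℕ := fun e => (univ.filter fun c => e ∈ ω c).card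

/-- **The comb coefficient** of the function family `f` at the profile `j`: the fibre sum of the `n`-copy kernel over all
`n`-tuples of configurations with profile `j` — for indicator families these are the INTEGER `n`-copy fibre counts of
`run/shared/lean/prim/MASTER-FAMILY.md` §MASTER / P3's HIERARCHY §1, and by `sahiE_bernoulliWeight_eq_sum_combCoeff` they are
the (unnormalised) degree-`n` tensor-Bernstein coefficients of `p ↦ E_n(μ_p; f)`. [this work] -/
def combCoeff (n : ℕ) (f : Fin n → Set ι → ℝ) (j : ι → ℕ) : ℝ :=
  ∑ ω ∈ univ.filter (fun ω : Fin n → Set ι => profile ω = j), copyKernel n f ω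

/-- Profiles lie in the box `j ≤ n`. [this work] -/
theorem profile_mem_box {n : ℕ} (ω : Fin n → Set ι) : profile ω ∈ box (fun _ : ι => n) := by
  rw [mem_box]
  intro e
  calc (univ.filter fun c => e ∈ ω c).card ≤ (univ : Finset (Fin n)).card := card_filter_le _ _
    _ = n := by rw [card_univ, Fintype.card_fin]

/-- Comb coefficients vanish outside the box. [this work] -/
theorem combCoeff_eq_zero_of_not_mem_box {n : ℕ} (f : Fin n → Set ι → ℝ) {j : ι → ℕ}
    (hj : j ∉ box (fun _ : ι => n)) : combCoeff n f j = 0 := by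
  unfold combCoeff
  refine sum_eq_zero fun ω hω => ?_
  exact absurd ((mem_filter.1 hω).2 ▸ profile_mem_box ω) hj

/-- **The product weight of `n` independent copies is the degree-`n` basis function of their profile**:
`∏_c μ_p(ω_c) = ∏_e p_e^{j_e}(1 − p_e)^{n − j_e}`. [this work] -/
theorem prod_bernoulliWeight_eq_bern (p : ι → unitInterval) {n : ℕ} (ω : Fin n → Set ι) :
    ∏ c, bernoulliWeight p (ω c) = bern (fun _ => n) (profile ω) p := by
  unfold bern profile
  simp only [bernoulliWeight, Literature.Probability.Percolation.BHK2006.weight]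
  rw [prod_comm]
  refine prod_congr rfl fun e _ => ?_
  rw [prod_ite, prod_const, prod_const]
  congr 2
  have h := card_filter_add_card_filter_not (s := (univ : Finset (Fin n))) (fun c => e ∈ ω c)
  rw [card_univ, Fintype.card_fin] at h
  omega

/-- **The Bernstein expansion of `E_n` with EXPLICIT coefficients, uniform in `n`**: under the product weight,
`E_n(μ_p; f) = Σ_{j ≤ n} combCoeff(f; j) · ∏_e p_e^{j_e}(1 − p_e)^{n − j_e}`. [this work] -/
theorem sahiE_bernoulliWeight_eq_sum_combCoeff (p : ι → unitInterval) (n : ℕ) (f : Fin n → Set ι → ℝ) :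
    sahiE (bernoulliWeight p) n f = ∑ j ∈ box (fun _ : ι => n), combCoeff n f j * bern (fun _ => n) j p := by
  rw [sahiE_eq_sum_copyKernel (sum_bernoulliWeight p)]
  simp_rw [prod_bernoulliWeight_eq_bern]
  unfold combCoeff
  rw [← sum_fiberwise_of_maps_to (s := univ) (t := box (fun _ : ι => n)) (g := profile)
    (fun ω _ => profile_mem_box ω)]
  refine sum_congr rfl fun j _ => ?_
  rw [sum_mul]
  refine sum_congr rfl fun ω hω => ?_
  rw [(mem_filter.1 hω).2, mul_comm]

/-- **Coefficientwise nonnegativity is a comb certificate**: if all comb coefficients of `f` are `≥ 0` then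
`p ↦ E_n(μ_p; f)` is comb-positive at multidegree `n` (P3's `CombPos`). [this work] -/
theorem combPos_of_combCoeff_nonneg {n : ℕ} {f : Fin n → Set ι → ℝ} (h : ∀ j, 0 ≤ combCoeff n f j) :
    CombPos (fun _ : ι => n) (fun p => sahiE (bernoulliWeight p) n f) :=
  ⟨combCoeff n f, h, fun p => sahiE_bernoulliWeight_eq_sum_combCoeff p n f⟩

/-! ### Face lemmas: the `j_e = 0` and `j_e = n` slices only see the `e`-sections -/

/-- On the face `j_e = 0` every copy is closed at `e`, so the coefficient only reads `f` off `e`. [this work] -/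
theorem combCoeff_congr_of_apply_eq_zero {n : ℕ} {f g : Fin n → Set ι → ℝ} (e : ι) {j : ι → ℕ} (hj : j e = 0)
    (hfg : ∀ i ω, e ∉ ω → f i ω = g i ω) : combCoeff n f j = combCoeff n g j := by
  unfold combCoeff
  refine sum_congr rfl fun ω hω => copyKernel_congr n fun i c => hfg i (ω c) fun hec => ?_
  have h0 : profile ω e = 0 := by rw [(mem_filter.1 hω).2, hj]
  unfold profile at h0
  rw [card_eq_zero, filter_eq_empty_iff] at h0
  exact h0 (mem_univ c) hec

/-- On the face `j_e = n` every copy is open at `e`. [this work] -/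
theorem combCoeff_congr_of_apply_eq_top {n : ℕ} {f g : Fin n → Set ι → ℝ} (e : ι) {j : ι → ℕ} (hj : j e = n)
    (hfg : ∀ i ω, e ∈ ω → f i ω = g i ω) : combCoeff n f j = combCoeff n g j := by
  unfold combCoeff
  refine sum_congr rfl fun ω hω => copyKernel_congr n fun i c => hfg i (ω c) ?_
  have h0 : profile ω e = n := by rw [(mem_filter.1 hω).2, hj]
  unfold profile at h0
  have huniv : (univ.filter fun c => e ∈ ω c) = univ :=
    eq_univ_of_card _ (by rw [h0, Fintype.card_fin])
  have hc : c ∈ univ.filter fun c => e ∈ ω c := by rw [huniv]; exact mem_univ c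
  exact (mem_filter.1 hc).2

omit [Fintype ι] in
/-- Off `e`, an event and its `e ← false` section agree on configurations closed at `e`. [folklore] -/
theorem ind_secAt_false_of_notMem (e : ι) (X : Set (Set ι)) {ω : Set ι} (he : e ∉ ω) :
    ind X ω = ind (secAt e false X) ω := by
  have hω : ω ∈ secAt e false X ↔ ω ∈ X := by
    rw [mem_secAt, forceAt_of_iff ⟨fun h => absurd h he, fun h => absurd h Bool.false_ne_true⟩]
  by_cases hX : ω ∈ X
  · rw [ind_of_mem hX, ind_of_mem (hω.2 hX)]
  · rw [ind_of_not_mem hX, ind_of_not_mem fun h => hX (hω.1 h)]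

omit [Fintype ι] in
/-- An event and its `e ← true` section agree on configurations open at `e`. [folklore] -/
theorem ind_secAt_true_of_mem (e : ι) (X : Set (Set ι)) {ω : Set ι} (he : e ∈ ω) :
    ind X ω = ind (secAt e true X) ω := by
  have hω : ω ∈ secAt e true X ↔ ω ∈ X := by
    rw [mem_secAt, forceAt_of_iff ⟨fun _ => rfl, fun _ => he⟩]
  by_cases hX : ω ∈ X
  · rw [ind_of_mem hX, ind_of_mem (hω.2 hX)]
  · rw [ind_of_not_mem hX, ind_of_not_mem fun h => hX (hω.1 h)]

/-- **Face lemma, `t = 0`**: the `j_e = 0` slice of the comb array of `(U_i)` is the comb array of the sections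
`(U_i^{e←0})`. [this work] -/
theorem combCoeff_ind_eq_secAt_false {n : ℕ} (U : Fin n → Set (Set ι)) (e : ι) {j : ι → ℕ} (hj : j e = 0) :
    combCoeff n (fun i => ind (U i)) j = combCoeff n (fun i => ind (secAt e false (U i))) j :=
  combCoeff_congr_of_apply_eq_zero e hj fun i _ hω => ind_secAt_false_of_notMem e (U i) hω

/-- **Face lemma, `t = n`**: the `j_e = n` slice of the comb array of `(U_i)` is the comb array of the sections
`(U_i^{e←1})`. [this work] -/
theorem combCoeff_ind_eq_secAt_true {n : ℕ} (U : Fin n → Set (Set ι)) (e : ι) {j : ι → ℕ} (hj : j e = n) :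
    combCoeff n (fun i => ind (U i)) j = combCoeff n (fun i => ind (secAt e true (U i))) j :=
  combCoeff_congr_of_apply_eq_top e hj fun i _ hω => ind_secAt_true_of_mem e (U i) hω

/-- Comb coefficients of a family of TRIVIAL events (`∅` or everything) are `≥ 0` (they vanish for `n ≥ 2`). [this work] -/
theorem combCoeff_ind_nonneg_of_trivial {n : ℕ} (U : Fin n → Set (Set ι)) (hU : ∀ i, U i = ∅ ∨ U i = Set.univ)
    (j : ι → ℕ) : 0 ≤ combCoeff n (fun i => ind (U i)) j := by
  unfold combCoeff
  refine sum_nonneg fun ω _ => ?_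
  match n, U, hU, ω with
  | 0, _, _, _ => exact le_rfl
  | 1, U, _, ω => exact ind_nonneg (U 0) (ω 0)
  | n + 2, U, hU, ω =>
    refine (copyKernel_add_two_eq_zero_of_const n ω fun i x y => ?_).ge
    rcases hU i with h | h
    · simp only [h, ind_of_not_mem (Set.notMem_empty _)]
    · simp only [h, ind_of_mem (Set.mem_univ _)]

end Comb

end SahiComb

end Summit.CriticalPhenomena.PercolationContinuityZ3.Theorems
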